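import Summits.QuantumFields.YangMills.Theorems.BalabanUVNodesN22ActivityStripSlot
import Literature.MathematicalPhysics.QuantumFieldTheory.Balaban1983to89.Node00.HistoryTermsOfRecord
import Literature.MathematicalPhysics.QuantumFieldTheory.Balaban1983to89.T4ActivityLipschitz

/-!
# BalabanUVNodes ∕ node N22 = NE9 — THE HISTORY-LIPSCHITZ ESTIMATE (2.40)–(2.41) AT THE W1 OBJECT (ROAD 1, Lipschitz currency): the DIFFERENCED
# (2.39)–(2.41) of [II] p. 21 (`T4ActivityLipschitz.norm_locE_sub_locE_le_of_small`) on the torus catalogue of the papers with the geometry clauses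
# located as numerals, then AT `Node00.W1.functionalOn ∕ functional`: W1's activity-level slot `ClusterStep.YoungLipschitz` (the NOT-PRINTED
# differenced (2.38), modulus table `ℓ`) + `Bound238` ⟹ `T4OutputRate.NE9` for the history functional of record with moduli `8·e·9·64·K₀(64,8)²·ℓ`,
# and `NE9 ∧ FadingMemory` (node N22's statement shape) as soon as the table fades

Cell `pub-ymgap`, HUMAN RULING D-0062 (Track A), R134 fan-out seat `pub-ymgap-dag-n22-c` (strategy s1: «the history-Lipschitz estimate (2.40)–(2.41)
p. 21 of [II] on the W1 object»), generation 0, fourth module — the row's title LITERALLY, in ROAD 1's currency (the lens seat `ym-lens-BalabanUVNodes-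
transfer` §3 recommendation: «type the modulus table ℓ as the W1-level INPUT (`YoungLipschitz S Wk sp ℓ r`) … the estimate of ℓ is [II] pp. 20–21 and is
the single unprinted line»).  THEOREMS ONLY (no `def`, no `def … : Prop`); imports this seat's slot module (p452837; for the torus numerals `K₀_four` ∕
`tgeometry_consts_four` through S25's cone), the W1 OBJECT `Node00.HistoryTermsOfRecord` (p455641) and `T4ActivityLipschitz` (the differenced transport)
BY NAME.  `--supports stmt-QuantumFields-19676` (K3 `SpineGivenEndpointR11`).

WHAT IS PRINTED ∕ NOT.  [II] p. 21 (2.39)–(2.41) bound ONE run's `E^{(k+1)}(X)` from Lemma 3 (2.38); the tree's `T4ActivityLipschitz` §4 transports a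
RELATIVE activity discrepancy `ε` (two activity families under ONE (2.38)-majorant, `‖w_A − w_B‖ ≤ ε·A e^{−R d}`) to `|E_A(X) − E_B(X)| ≤ 8ε·(eνc₁K₀²)·
A·e^{−r₁ d(X)}` (NOT PRINTED — the comparison of two histories is the cell's NE9).  AT THE W1 OBJECT the two families are the activities `(S k).H` of
(2.11) at two coupling histories `g, g′` of the window, the discrepancy is W1's `YoungLipschitz` table `Σ_i ℓ_i |g_i − g′_i|` ((2.38) differenced in the
young couplings — node N10's T-row DIFFERENCED, displayed, asserted nowhere), and the conclusion is `T4OutputRate.NE9` for `W1.functionalOn S p emb`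
with moduli `Λ (k+1) i = 8·e·9·64·K₀(64,8)²·ℓ (k+1) i` — by `rfl` on the (2.13) representation ((2.13) is DEFINITIONAL in W1).

WHAT.
* §1 `norm_locE_sub_locE_le_of_geometry` — `T4ActivityLipschitz.norm_locE_sub_locE_le_of_small` fed by a `B13Resummation.Geometry` (c = 5, b = 5r₁;
  S25's pattern); `norm_locE_sub_locE_le_torus4` — on `tsys 4 N` ∕ `TTouch` ∕ `(·.1)` ∕ `torusTreeLen` with the clauses as numerals
  (`r₁ + 2·64·log 162 + 2 ≤ R`, `2A·e^{5r₁+1}·K₀(64,8)·9·64 ≤ 1`): `‖E_A(X₀) − E_B(X₀)‖ ≤ 8ε·(e·9·64·K₀(64,8)²·A)·e^{−r₁ d(X₀)}`.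
* §2 `ne9_functionalOn_of_youngLipschitz` — W1's `Bound238 (S k) (box γ k) (sp k) A R` + `YoungLipschitz (S k) (box γ k) (sp k) (ℓ (k+1) ·) R` at
  every step, backgrounds of `B` read inside the spaces (`emb U ∈ sp k Z`), §1's numerals, `κ ≤ r₁` ⟹ `NE9 (functionalOn S p emb) (Window γ) κ
  (fun n i => 8·e·9·64·K₀(64,8)²·ℓ n i)`; `ne9_functional_of_youngLipschitz` (`emb := ofBackgroundC ι`).
* §3 `fadingMemory_table_smul` — a fading table stays fading under a nonnegative scalar; `ne9_and_fadingMemory_functionalOn_of_youngLipschitz` ∕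
  `ne9_and_fadingMemory_functional_of_youngLipschitz` — node N22's statement SHAPE `NE9 ∧ FadingMemory` for the W1 functional from the two W1 slots + «the table fades»
  (`0 ≤ ℓ n i ≤ C₉·ω^{n−i}` — the located N2∕contraction content, displayed).
* §4 `youngLipschitz_of_termwise` — the TERMWISE producer of W1's `YoungLipschitz` (node N10's currency: termwise young-coupling Lipschitz tables
  summed under the decay, (2.26) p. 17 differenced).
* §5 `slots_termlessStep` — NON-VACUITY (A5 rider): the termless model step carries both slots (`Bound238`, `YoungLipschitz`).

HONEST FRAMING.  Count-neutral by-name knit AT THE OBJECT; NOT a discharge of N22 (no `RRec` home instanced; `YoungLipschitz` = the differenced (2.38)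
and its fading are DISPLAYED hypotheses — NOT PRINTED, node N10's T-row differenced + the adjudication ω < 1; nothing of Bałaban's asserted).  NE9 NOT
IN PRINT, NOT PROVED; one finite four-torus programme at fixed ε — NOT infinite volume, NOT OS on ℝ⁴, NOT a mass gap, NOT Clay.  0 `sorry`, 0 `def`,
standard axioms.

References (TYPES only): [I] = [Balaban1987RG1] T. Bałaban, Commun. Math. Phys. **109** (1987) 249–301 — p. 256, p. 263, p. 298; [II] =
[Balaban1988RG2Cluster] T. Bałaban, Commun. Math. Phys. **116** (1988) 1–22 — (2.11)–(2.14) pp. 14–15, Lemma 3 (2.38) p. 20, (2.39)–(2.41) p. 21;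
[KoteckyPreiss1986] Thm p. 492.
-/

noncomputable section

namespace YMDAG.N22.W1

open Set Metric
open scoped BigOperators
open Literature.MathematicalPhysics.QuantumFieldTheory.Balaban1983to89
open Literature.MathematicalPhysics.QuantumFieldTheory.Balaban1983to89.T4Continuum (T4Family)
open Literature.MathematicalPhysics.QuantumFieldTheory.Balaban1983to89.T4OutputRate
open Literature.MathematicalPhysics.QuantumFieldTheory.Balaban1983to89.B13Resummation (locE Geometry)
open Literature.MathematicalPhysics.QuantumFieldTheory.Balaban1983to89.TreeLengthTorus (TPt TDom tsys torusTreeLen torusTreeLen_nonneg)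
open Literature.MathematicalPhysics.QuantumFieldTheory.Balaban1983to89.TreeLengthTorusGeometry (TTouch tgeometry tgeometry_consts_four)
open Literature.MathematicalPhysics.QuantumFieldTheory.Balaban1983to89.B12TreeDecay (K₀ K₀_pos)
open Literature.MathematicalPhysics.QuantumFieldTheory.Balaban1983to89.T4ActivityLipschitz (norm_locE_sub_locE_le_of_small)
open Literature.MathematicalPhysics.QuantumFieldTheory.Balaban1983to89.Node00
open Literature.MathematicalPhysics.QuantumFieldTheory.Balaban1983to89.Node00.Sect2 (domSys domCount CPair ofBackgroundC)
open Literature.MathematicalPhysics.QuantumFieldTheory.Balaban1983to89.Node00.W1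
open Summit.QuantumFields.BalabanUV.T4Continuum.NE1p.DressedSmallFieldGeometryFaces (K₀_four)

/-! ## §1 The differenced (2.39)–(2.41) over a polymer geometry and on the torus catalogue of the papers -/

section OfGeometry
variable {D : LocDomainSys} {Cube : Type} [DecidableEq Cube] [DecidableEq D.Dom] (G : Geometry D Cube) [DecidableRel G.ι]

/-- **THE DIFFERENCED (2.39)–(2.41) OVER A POLYMER GEOMETRY** (`T4ActivityLipschitz.norm_locE_sub_locE_le_of_small` BY NAME with the geometry ∕ sign
sockets fed from `G` at the footprint `G.cubes X₀`, print's (2.27) constant `c = 5`, `b = 5r₁`): two activity families under ONE (2.38)-shape majorant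
`A e^{−R d}` on the polymers inside `X₀`, differing by `ε` times it, the rate clause `r₁ + 2G.κ₀ + 2 ≤ R` and the DOUBLED smallness
`2A·e^{5r₁+1}·G.K₀·G.ν·G.c₁ ≤ 1` give `‖E_A(X₀) − E_B(X₀)‖ ≤ 8ε·(e·G.ν·G.c₁·G.K₀²·A)·e^{−r₁ d(X₀)}`. [cite: Balaban1988RG2Cluster, (2.39)-(2.41) p.21] -/
theorem norm_locE_sub_locE_le_of_geometry {wA wB : D.Dom → ℂ} {A R r₁ ε : ℝ} (X₀ : D.Dom)
    (hA : 0 ≤ A) (hr₁ : 0 ≤ r₁) (hε : 0 ≤ ε) (hrate : r₁ + 2 * G.κ₀ + 2 ≤ R)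
    (hsmall : 2 * A * Real.exp (5 * r₁ + 1) * G.K₀ * G.ν * G.c₁ ≤ 1)
    (hwA : ∀ Z, G.cubes Z ⊆ G.cubes X₀ → ‖wA Z‖ ≤ A * Real.exp (-(R * D.dj Z)))
    (hwB : ∀ Z, G.cubes Z ⊆ G.cubes X₀ → ‖wB Z‖ ≤ A * Real.exp (-(R * D.dj Z)))
    (hAB : ∀ Z, G.cubes Z ⊆ G.cubes X₀ → ‖wA Z - wB Z‖ ≤ ε * (A * Real.exp (-(R * D.dj Z)))) :
    ‖locE G.ι G.cubes wA (G.cubes X₀) - locE G.ι G.cubes wB (G.cubes X₀)‖ ≤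
      8 * ε * (Real.exp 1 * G.ν * G.c₁ * G.K₀ ^ 2 * A * Real.exp (-(r₁ * D.dj X₀))) := by
  haveI : Std.Refl G.ι := ⟨G.ι_refl⟩
  haveI : Std.Symm G.ι := ⟨G.ι_symm⟩
  exact norm_locE_sub_locE_le_of_small G.ι (c := 5) (b := 5 * r₁) G.loc G.reach_le D.dj_nonneg hA G.K₀_nonneg G.c₁_nonneg G.ν_nonneg
    G.κ₀_nonneg hr₁ (by norm_num) (le_of_eq (by ring)) hε hwA hwB hAB G.ineq126 G.volBound (G.ineq227 X₀) hrate hsmall (G.cubes_nonempty X₀)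

end OfGeometry

section Torus
variable {N : ℕ} [NeZero N]

open Classical in
/-- **THE DIFFERENCED (2.39)–(2.41) ON THE TORUS CATALOGUE OF THE PAPERS — NO GEOMETRY HYPOTHESIS** (`tsys 4 N`, incompatibility `TTouch`, footprint
`(·.1)`, `d = torusTreeLen`; the clauses located as numerals: ν = 9, κ₀ = 64·log 162, c₁ = 64, K₀ = K₀(64,8) — `tgeometry_consts_four`, `K₀_four`):
two activity families under ONE majorant `A·e^{−R·d(Z)}` inside `X₀`, differing by `ε` times it, `r₁ + 2·64·log 162 + 2 ≤ R` and
`2A·e^{5r₁+1}·K₀(64,8)·9·64 ≤ 1` give `‖E_A(X₀) − E_B(X₀)‖ ≤ 8ε·(e·9·64·K₀(64,8)²·A)·e^{−r₁·d(X₀)}`. [cite: Balaban1988RG2Cluster, (2.39)-(2.41) p.21] -/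
theorem norm_locE_sub_locE_le_torus4 {wA wB : (tsys 4 N).Dom → ℂ} {A R r₁ ε : ℝ} (X₀ : (tsys 4 N).Dom)
    (hA : 0 ≤ A) (hr₁ : 0 ≤ r₁) (hε : 0 ≤ ε) (hrate : r₁ + 2 * (64 * Real.log 162) + 2 ≤ R)
    (hsmall : 2 * A * Real.exp (5 * r₁ + 1) * K₀ 64 8 * 9 * 64 ≤ 1)
    (hwA : ∀ Z : (tsys 4 N).Dom, Z.1 ⊆ X₀.1 → ‖wA Z‖ ≤ A * Real.exp (-(R * torusTreeLen Z.1)))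
    (hwB : ∀ Z : (tsys 4 N).Dom, Z.1 ⊆ X₀.1 → ‖wB Z‖ ≤ A * Real.exp (-(R * torusTreeLen Z.1)))
    (hAB : ∀ Z : (tsys 4 N).Dom, Z.1 ⊆ X₀.1 → ‖wA Z - wB Z‖ ≤ ε * (A * Real.exp (-(R * torusTreeLen Z.1)))) :
    ‖locE (TTouch (d := 4) (N := N)) (fun Z : (tsys 4 N).Dom => Z.1) wA X₀.1 -
        locE (TTouch (d := 4) (N := N)) (fun Z : (tsys 4 N).Dom => Z.1) wB X₀.1‖ ≤
      8 * ε * (Real.exp 1 * 9 * 64 * K₀ 64 8 ^ 2 * A * Real.exp (-(r₁ * torusTreeLen X₀.1))) := by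
  obtain ⟨hν, hκ, hc⟩ := tgeometry_consts_four N
  have hK := K₀_four (N := N)
  have h := norm_locE_sub_locE_le_of_geometry (tgeometry 4 N) (wA := wA) (wB := wB) (R := R) X₀ hA hr₁ hε
    (by rw [hκ]; exact hrate) (by rw [hK, hν, hc]; exact hsmall) hwA hwB hAB
  rw [hν, hc, hK] at h
  exact h

end Torus

/-! ## §2 NE9 for the W1 history functional from W1's two activity-level slots -/

variable (F : T4Family) (K : ℕ) {𝔸 : Type*} {M : ℕ}

open Classical in
/-- **THE HISTORY-LIPSCHITZ ESTIMATE (2.40)–(2.41) AT THE W1 OBJECT ⟹ NE9.**  For W1's cluster tower `S` on the Record11 torus catalogue, backgrounds of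
`B` read in `Φ` through `emb` INSIDE the space tables (`emb U ∈ sp k Z` — `B` = the admissible backgrounds of the run), and at every step `k`: W1's
`Bound238 (S k) (box γ k) (sp k) A R` (Lemma 3 (2.38) — node N10's T-row, displayed) and `YoungLipschitz (S k) (box γ k) (sp k) (ℓ (k+1) ·) R` (the
differenced (2.38), modulus table `ℓ` — NOT PRINTED, displayed); §1's numerals with the DOUBLED smallness; `κ ≤ r₁`; `A > 0`.  THEN
`T4OutputRate.NE9 (W1.functionalOn S p emb) (Window γ) κ (fun n i => 8·e·9·64·K₀(64,8)²·ℓ n i)`: for every domain `⟨k+1, X⟩` and two window histories,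
`|E(g) − E(g′)| ≤ e^{−κ d(X)}·Σ_{i ≤ k} (8·e·576·K₀²·ℓ (k+1) i)·|g_i − g′_i|` (scale 0: no term).  Proof: §1 on the torus at the two activity families
`(S k).Hh g (emb U)`, `(S k).Hh g′ (emb U)` with relative discrepancy `ε = (Σ_i ℓ_i|g_i − g′_i|)∕A`, then `|Re z| ≤ ‖z‖` and `e^{−r₁ d} ≤ e^{−κ d}`;
the (2.13) representation is `rfl` (W1). [folklore] -/
theorem ne9_functionalOn_of_youngLipschitz (S : ClusterTower (F.P K) 𝔸 M) (p : RunPairing) {B : Type} (emb : B → CPair (F.P K) 𝔸)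
    (sp : (k : ℕ) → (domSys (F.P K) M (k + 1)).Dom → Set (CPair (F.P K) 𝔸)) (hsp : ∀ (k : ℕ) (U : B) Z, emb U ∈ sp k Z)
    {γ κ A R r₁ : ℝ} (ℓ : ℕ → ℕ → ℝ) (hA : 0 < A) (hr₁ : 0 ≤ r₁) (hκ : κ ≤ r₁) (hrate : r₁ + 2 * (64 * Real.log 162) + 2 ≤ R)
    (hsmall : 2 * A * Real.exp (5 * r₁ + 1) * K₀ 64 8 * 9 * 64 ≤ 1) (hℓ : ∀ n i, i < n → 0 ≤ ℓ n i)
    (h238 : ∀ k, (S k).Bound238 (box γ k) (sp k) A R)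
    (hYL : ∀ k, (S k).YoungLipschitz (box γ k) (sp k) (fun i : Fin (k + 1) => ℓ (k + 1) i) R) :
    NE9 (functionalOn S p emb) (Window γ) κ (fun n i => 8 * (Real.exp 1 * 9 * 64 * K₀ 64 8 ^ 2) * ℓ n i) := by
  intro g hg g' hg' U X
  obtain ⟨j, X'⟩ := X
  cases j with
  | zero =>
    -- no term is created at step 0: both values are `Re 0`
    show |(termC S 0 X' g (emb U)).re - (termC S 0 X' g' (emb U)).re| ≤ _
    simp
  | succ k =>
    -- numerics first (kept away from the heavy hypotheses below)
    have hK : 0 < K₀ 64 8 := K₀_pos 64 8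
    have hM : 0 ≤ Real.exp 1 * 9 * 64 * K₀ 64 8 ^ 2 := by positivity
    have hexp : Real.exp (-(r₁ * torusTreeLen X'.1)) ≤ Real.exp (-(κ * torusTreeLen X'.1)) :=
      Real.exp_le_exp.2 (neg_le_neg (mul_le_mul_of_nonneg_right hκ (torusTreeLen_nonneg _)))
    -- the history discrepancy `L = Σ_{i ≤ k} ℓ (k+1) i |g_i − g′_i|` and its algebra
    set L : ℝ := ∑ i : Fin (k + 1), ℓ (k + 1) i * |g i - g' i| with hL_def
    have hL0 : 0 ≤ L := Finset.sum_nonneg fun i _ => mul_nonneg (hℓ _ _ i.2) (abs_nonneg _)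
    have hA0 : A ≠ 0 := hA.ne'
    have halg : ∀ e : ℝ, 8 * (L / A) * (Real.exp 1 * 9 * 64 * K₀ 64 8 ^ 2 * A * e) =
        e * (8 * (Real.exp 1 * 9 * 64 * K₀ 64 8 ^ 2) * L) := by
      intro e
      field_simp
    have hdiv : ∀ e : ℝ, L / A * (A * e) = e * L := by
      intro e
      field_simp
    have hsumrange : ∑ i ∈ Finset.range (k + 1), 8 * (Real.exp 1 * 9 * 64 * K₀ 64 8 ^ 2) * ℓ (k + 1) i * |g i - g' i| =
        8 * (Real.exp 1 * 9 * 64 * K₀ 64 8 ^ 2) * L := by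
      rw [Finset.sum_range, hL_def, Finset.mul_sum]
      exact Finset.sum_congr rfl fun i _ => by ring
    -- the two activity families of step k at the two histories, under ONE majorant, differing by `(L∕A)`·majorant
    have hgk : restrictPrefix k g ∈ box γ k := restrictPrefix_mem_box hg k
    have hg'k : restrictPrefix k g' ∈ box γ k := restrictPrefix_mem_box hg' k
    have hwA : ∀ Z : (domSys (F.P K) M (k + 1)).Dom, Z.1 ⊆ X'.1 →
        ‖(fun Z => (S k).Hh g (emb U) Z) Z‖ ≤ A * Real.exp (-(R * torusTreeLen Z.1)) :=
      fun Z _ => h238 k _ hgk Z _ (hsp k U Z)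
    have hwB : ∀ Z : (domSys (F.P K) M (k + 1)).Dom, Z.1 ⊆ X'.1 →
        ‖(fun Z => (S k).Hh g' (emb U) Z) Z‖ ≤ A * Real.exp (-(R * torusTreeLen Z.1)) :=
      fun Z _ => h238 k _ hg'k Z _ (hsp k U Z)
    have hAB : ∀ Z : (domSys (F.P K) M (k + 1)).Dom, Z.1 ⊆ X'.1 →
        ‖(fun Z => (S k).Hh g (emb U) Z) Z - (fun Z => (S k).Hh g' (emb U) Z) Z‖ ≤
          L / A * (A * Real.exp (-(R * torusTreeLen Z.1))) := by
      intro Z _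
      have h := hYL k _ hgk _ hg'k Z _ (hsp k U Z)
      have hsum : ∑ i : Fin (k + 1), ℓ (k + 1) i * |restrictPrefix k g i - restrictPrefix k g' i| = L := by
        simp only [restrictPrefix_apply, hL_def]
      rw [hdiv, ← hsum]
      exact h
    have key := norm_locE_sub_locE_le_torus4 (N := domCount (F.P K) M (k + 1)) (wA := fun Z => (S k).Hh g (emb U) Z)
      (wB := fun Z => (S k).Hh g' (emb U) Z) X' hA.le hr₁ (div_nonneg hL0 hA.le) hrate hsmall hwA hwB hAB
    -- the (2.13) representation of the W1 functional at `⟨k+1, X'⟩` is `rfl`; read the difference of the real parts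
    have e1 : functionalOn S p emb g U ⟨k + 1, X'⟩ =
        (locE (TTouch (d := 4) (N := domCount (F.P K) M (k + 1))) (fun Z : (tsys 4 (domCount (F.P K) M (k + 1))).Dom => Z.1)
          (fun Z => (S k).Hh g (emb U) Z) X'.1).re :=
      rfl
    have e2 : functionalOn S p emb g' U ⟨k + 1, X'⟩ =
        (locE (TTouch (d := 4) (N := domCount (F.P K) M (k + 1))) (fun Z : (tsys 4 (domCount (F.P K) M (k + 1))).Dom => Z.1)
          (fun Z => (S k).Hh g' (emb U) Z) X'.1).re :=
      rfl
    have hre : |(functionalOn S p emb g U ⟨k + 1, X'⟩) - (functionalOn S p emb g' U ⟨k + 1, X'⟩)| ≤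
        ‖locE (TTouch (d := 4) (N := domCount (F.P K) M (k + 1))) (fun Z : (tsys 4 (domCount (F.P K) M (k + 1))).Dom => Z.1)
            (fun Z => (S k).Hh g (emb U) Z) X'.1 -
          locE (TTouch (d := 4) (N := domCount (F.P K) M (k + 1))) (fun Z : (tsys 4 (domCount (F.P K) M (k + 1))).Dom => Z.1)
            (fun Z => (S k).Hh g' (emb U) Z) X'.1‖ := by
      rw [e1, e2, ← Complex.sub_re]
      exact Complex.abs_re_le_norm _
    have main : |(functionalOn S p emb g U ⟨k + 1, X'⟩) - (functionalOn S p emb g' U ⟨k + 1, X'⟩)| ≤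
        Real.exp (-(κ * torusTreeLen X'.1)) * (8 * (Real.exp 1 * 9 * 64 * K₀ 64 8 ^ 2) * L) :=
      calc |(functionalOn S p emb g U ⟨k + 1, X'⟩) - (functionalOn S p emb g' U ⟨k + 1, X'⟩)|
          ≤ 8 * (L / A) * (Real.exp 1 * 9 * 64 * K₀ 64 8 ^ 2 * A * Real.exp (-(r₁ * torusTreeLen X'.1))) := hre.trans key
        _ = Real.exp (-(r₁ * torusTreeLen X'.1)) * (8 * (Real.exp 1 * 9 * 64 * K₀ 64 8 ^ 2) * L) := halg _
        _ ≤ Real.exp (-(κ * torusTreeLen X'.1)) * (8 * (Real.exp 1 * 9 * 64 * K₀ 64 8 ^ 2) * L) :=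
            mul_le_mul_of_nonneg_right hexp (mul_nonneg (mul_nonneg (by norm_num) hM) hL0)
    -- the goal's carrier letters: `scale ⟨k+1, X'⟩ = k+1`, `d ⟨k+1, X'⟩ = torusTreeLen X'`
    simp only [histCarriers_scale, histCarriers_d]
    rw [hsumrange]
    exact main

open Classical in
/-- **NE9 FOR THE FUNCTIONAL OF RECORD `W1.functional S ι p`** from W1's two activity-level slots (`emb := Sect2.ofBackgroundC ι`; the spaces must contain
the readings of the real backgrounds quantified over — `ofBackgroundC ι U ∈ sp k Z`). [folklore] -/
theorem ne9_functional_of_youngLipschitz [Ring 𝔸] (S : ClusterTower (F.P K) 𝔸 M) {G : Type} [Group G] (ι : G →* 𝔸ˣ) (p : RunPairing)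
    (sp : (k : ℕ) → (domSys (F.P K) M (k + 1)).Dom → Set (CPair (F.P K) 𝔸))
    (hsp : ∀ (k : ℕ) (U : GaugeField (F.P K) 0 G) Z, ofBackgroundC ι U ∈ sp k Z)
    {γ κ A R r₁ : ℝ} (ℓ : ℕ → ℕ → ℝ) (hA : 0 < A) (hr₁ : 0 ≤ r₁) (hκ : κ ≤ r₁) (hrate : r₁ + 2 * (64 * Real.log 162) + 2 ≤ R)
    (hsmall : 2 * A * Real.exp (5 * r₁ + 1) * K₀ 64 8 * 9 * 64 ≤ 1) (hℓ : ∀ n i, i < n → 0 ≤ ℓ n i)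
    (h238 : ∀ k, (S k).Bound238 (box γ k) (sp k) A R)
    (hYL : ∀ k, (S k).YoungLipschitz (box γ k) (sp k) (fun i : Fin (k + 1) => ℓ (k + 1) i) R) :
    NE9 (functional S ι p) (Window γ) κ (fun n i => 8 * (Real.exp 1 * 9 * 64 * K₀ 64 8 ^ 2) * ℓ n i) :=
  ne9_functionalOn_of_youngLipschitz F K S p (ofBackgroundC ι) sp hsp ℓ hA hr₁ hκ hrate hsmall hℓ h238 hYL

/-! ## §3 Node N22's statement shape `NE9 ∧ FadingMemory` for the W1 functional, once the table fades -/

/-- A FADING modulus table stays fading under a nonnegative scalar: `0 ≤ ℓ n i ≤ C₉ ω^{n−i}` (`i ≤ n`) ⟹ `FadingMemory (c·C₉) ω (c·ℓ)` for `c ≥ 0`.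
[folklore] -/
theorem fadingMemory_table_smul {ℓ : ℕ → ℕ → ℝ} {C₉ ω c : ℝ} (hc : 0 ≤ c) (hℓ : FadingMemory C₉ ω ℓ) :
    FadingMemory (c * C₉) ω (fun n i => c * ℓ n i) := by
  intro n i hi
  obtain ⟨h0, h1⟩ := hℓ n i hi
  exact ⟨mul_nonneg hc h0, by rw [mul_assoc]; exact mul_le_mul_of_nonneg_left h1 hc⟩

open Classical in
/-- **NODE N22's STATEMENT SHAPE AT THE W1 OBJECT (ROAD 1).**  W1's `Bound238` + `YoungLipschitz` with a FADING table (`FadingMemory C₉ ω ℓ`: `0 ≤ ℓ n i ≤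
C₉ ω^{n−i}` — the located contraction content, displayed) ⟹ `NE9 (functionalOn S p emb) (Window γ) κ Λ ∧ FadingMemory (8·e·576·K₀(64,8)²·C₉) ω Λ` with
`Λ n i = 8·e·576·K₀(64,8)²·ℓ n i` — the pair `YMDAG.UVSplit.N22At` reads on a U3 bundle whose `EA` is the W1 functional. [folklore] -/
theorem ne9_and_fadingMemory_functionalOn_of_youngLipschitz (S : ClusterTower (F.P K) 𝔸 M) (p : RunPairing) {B : Type}
    (emb : B → CPair (F.P K) 𝔸) (sp : (k : ℕ) → (domSys (F.P K) M (k + 1)).Dom → Set (CPair (F.P K) 𝔸))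
    (hsp : ∀ (k : ℕ) (U : B) Z, emb U ∈ sp k Z) {γ κ A R r₁ C₉ ω : ℝ} (ℓ : ℕ → ℕ → ℝ) (hA : 0 < A) (hr₁ : 0 ≤ r₁) (hκ : κ ≤ r₁)
    (hrate : r₁ + 2 * (64 * Real.log 162) + 2 ≤ R) (hsmall : 2 * A * Real.exp (5 * r₁ + 1) * K₀ 64 8 * 9 * 64 ≤ 1)
    (hfade : FadingMemory C₉ ω ℓ)
    (h238 : ∀ k, (S k).Bound238 (box γ k) (sp k) A R)
    (hYL : ∀ k, (S k).YoungLipschitz (box γ k) (sp k) (fun i : Fin (k + 1) => ℓ (k + 1) i) R) :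
    NE9 (functionalOn S p emb) (Window γ) κ (fun n i => 8 * (Real.exp 1 * 9 * 64 * K₀ 64 8 ^ 2) * ℓ n i) ∧
      FadingMemory (8 * (Real.exp 1 * 9 * 64 * K₀ 64 8 ^ 2) * C₉) ω (fun n i => 8 * (Real.exp 1 * 9 * 64 * K₀ 64 8 ^ 2) * ℓ n i) := by
  have hℓ : ∀ n i, i < n → 0 ≤ ℓ n i := fun n i hi => (hfade n i hi.le).1
  exact ⟨ne9_functionalOn_of_youngLipschitz F K S p emb sp hsp ℓ hA hr₁ hκ hrate hsmall hℓ h238 hYL,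
    fadingMemory_table_smul (by positivity) hfade⟩

open Classical in
/-- **NODE N22's STATEMENT SHAPE FOR THE FUNCTIONAL OF RECORD `W1.functional S ι p` (ROAD 1)** — §3 at `emb := Sect2.ofBackgroundC ι`. [folklore] -/
theorem ne9_and_fadingMemory_functional_of_youngLipschitz [Ring 𝔸] (S : ClusterTower (F.P K) 𝔸 M) {G : Type} [Group G] (ι : G →* 𝔸ˣ)
    (p : RunPairing) (sp : (k : ℕ) → (domSys (F.P K) M (k + 1)).Dom → Set (CPair (F.P K) 𝔸))
    (hsp : ∀ (k : ℕ) (U : GaugeField (F.P K) 0 G) Z, ofBackgroundC ι U ∈ sp k Z) {γ κ A R r₁ C₉ ω : ℝ} (ℓ : ℕ → ℕ → ℝ) (hA : 0 < A)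
    (hr₁ : 0 ≤ r₁) (hκ : κ ≤ r₁) (hrate : r₁ + 2 * (64 * Real.log 162) + 2 ≤ R)
    (hsmall : 2 * A * Real.exp (5 * r₁ + 1) * K₀ 64 8 * 9 * 64 ≤ 1) (hfade : FadingMemory C₉ ω ℓ)
    (h238 : ∀ k, (S k).Bound238 (box γ k) (sp k) A R)
    (hYL : ∀ k, (S k).YoungLipschitz (box γ k) (sp k) (fun i : Fin (k + 1) => ℓ (k + 1) i) R) :
    NE9 (functional S ι p) (Window γ) κ (fun n i => 8 * (Real.exp 1 * 9 * 64 * K₀ 64 8 ^ 2) * ℓ n i) ∧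
      FadingMemory (8 * (Real.exp 1 * 9 * 64 * K₀ 64 8 ^ 2) * C₉) ω (fun n i => 8 * (Real.exp 1 * 9 * 64 * K₀ 64 8 ^ 2) * ℓ n i) :=
  ne9_and_fadingMemory_functionalOn_of_youngLipschitz F K S p (ofBackgroundC ι) sp hsp ℓ hA hr₁ hκ hrate hsmall hfade h238 hYL

/-! ## §4 The termwise producer of W1's `YoungLipschitz` (node N10's currency) -/

/-- **TERMWISE ⟹ ACTIVITY-WISE (Lipschitz currency).**  If every term (2.14) localizing at `Z` is Lipschitz in the young couplings on the box with a
table `m j i` (`‖T j g φ − T j g′ φ‖ ≤ Σ_i m j i·|g_i − g′_i|` on the space) and the tables sum under the decay `Σ_{j ∈ idx Z} m j i ≤ e^{−r d(Z)}·ℓ i`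
((2.26) p. 17 differenced and resummed as in Lemma 3 — node N10's currency), then the activity `H(Z) = Σ_j T j` ((2.11)) carries W1's
`YoungLipschitz S Wk sp ℓ r` (finite sums; `‖Σ‖ ≤ Σ‖·‖`; exchange of the two finite sums). [folklore] -/
theorem youngLipschitz_of_termwise {P : Params} {k : ℕ} (S : ClusterStep P 𝔸 M k) (Wk : Set (Fin (k + 1) → ℝ))
    (sp : (domSys P M (k + 1)).Dom → Set (CPair P 𝔸)) (ℓ : Fin (k + 1) → ℝ) (r : ℝ) (m : S.Idx → Fin (k + 1) → ℝ)
    (hT : ∀ g ∈ Wk, ∀ g' ∈ Wk, ∀ Z, ∀ φ ∈ sp Z, ∀ j ∈ S.idx Z, ‖S.T j g φ - S.T j g' φ‖ ≤ ∑ i, m j i * |g i - g' i|)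
    (hm : ∀ Z i, ∑ j ∈ S.idx Z, m j i ≤ Real.exp (-(r * (domSys P M (k + 1)).dj Z)) * ℓ i) :
    S.YoungLipschitz Wk sp ℓ r := by
  intro g hg g' hg' Z φ hφ
  have hsplit : S.H g φ Z - S.H g' φ Z = ∑ j ∈ S.idx Z, (S.T j g φ - S.T j g' φ) := by
    simp only [ClusterStep.H, Finset.sum_sub_distrib]
  calc ‖S.H g φ Z - S.H g' φ Z‖ = ‖∑ j ∈ S.idx Z, (S.T j g φ - S.T j g' φ)‖ := by rw [hsplit]
    _ ≤ ∑ j ∈ S.idx Z, ‖S.T j g φ - S.T j g' φ‖ := norm_sum_le _ _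
    _ ≤ ∑ j ∈ S.idx Z, ∑ i, m j i * |g i - g' i| := Finset.sum_le_sum fun j hj => hT g hg g' hg' Z φ hφ j hj
    _ = ∑ i, (∑ j ∈ S.idx Z, m j i) * |g i - g' i| := by
        rw [Finset.sum_comm]
        exact Finset.sum_congr rfl fun i _ => by rw [Finset.sum_mul]
    _ ≤ ∑ i, (Real.exp (-(r * (domSys P M (k + 1)).dj Z)) * ℓ i) * |g i - g' i| :=
        Finset.sum_le_sum fun i _ => mul_le_mul_of_nonneg_right (hm Z i) (abs_nonneg _)
    _ = Real.exp (-(r * (domSys P M (k + 1)).dj Z)) * ∑ i, ℓ i * |g i - g' i| := by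
        rw [Finset.mul_sum]
        exact Finset.sum_congr rfl fun i _ => by ring

/-! ## §5 Non-vacuity of the two displayed slots (A5 rider) -/

/-- **NON-VACUITY (A5 rider).**  The two displayed W1 slots are jointly satisfiable: the termless MODEL step (`idx Z = ∅`, so `H ≡ 0`) carries
`Bound238` for every `A ≥ 0` and `YoungLipschitz` for every nonnegative table — so §2–§3 are not vacuous implications.  (Model step, NOT NODE 00's.)
[folklore] -/
theorem slots_termlessStep {P : Params} {k : ℕ} (Wk : Set (Fin (k + 1) → ℝ)) (sp : (domSys P M (k + 1)).Dom → Set (CPair P 𝔸))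
    {A r : ℝ} (hA : 0 ≤ A) (ℓ : Fin (k + 1) → ℝ) (hℓ : ∀ i, 0 ≤ ℓ i) :
    (⟨PUnit, fun _ => ∅, fun _ _ _ => 0⟩ : ClusterStep P 𝔸 M k).Bound238 Wk sp A r ∧
      (⟨PUnit, fun _ => ∅, fun _ _ _ => 0⟩ : ClusterStep P 𝔸 M k).YoungLipschitz Wk sp ℓ r := by
  refine ⟨fun g _ Z φ _ => ?_, fun g _ g' _ Z φ _ => ?_⟩
  · simp only [ClusterStep.H, Finset.sum_empty, norm_zero]
    positivity
  · simp only [ClusterStep.H, Finset.sum_empty, sub_self, norm_zero]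
    exact mul_nonneg (Real.exp_nonneg _) (Finset.sum_nonneg fun i _ => mul_nonneg (hℓ i) (abs_nonneg _))

end YMDAG.N22.W1




end
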